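import Literature.NumberTheory.EllipticCurves.Rank1Residual.X11RankOneCertificates.InputsPublished
import Literature.NumberTheory.EllipticCurves.Rank1Residual.X11RankOneCertificates.RecordsN20000Part1
import Literature.NumberTheory.EllipticCurves.Rank1Residual.X11RankOneCertificates.RecordsN20000Part2
import Literature.NumberTheory.EllipticCurves.BSDAnalyticRankTunnellCMProofs
import HarnessLib

/-!
# X11 at rank one beyond `p = 3` — global minimality of a record's model FROM the record (the last instance binder)

HONEST FRAMING (cell `b2b-bsdres`, verbatim): prove what is provable now; shrink each hard class to its
core with data; no claim beyond stated classes; the cell deletes COMBINATION-shaped classes from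
PUBLISHED theorems only, the CONSTRUCTION-shaped remainder is typed; this is not "finishing BSD".

After `Instances.lean` the only instance hypothesis left in the record theorems is
`[r.curve.IsGloballyMinimal]` (Cremona's model is a reduced global minimal model). This file discharges
it IN THE KERNEL for every record that passes Silverman's sufficient criterion (AEC VII.1 Remark 1.1):
an integral equation is minimal at `v` as soon as `ord_v Δ < 12` OR `ord_v c₄ < 4`. For an INTEGER
model `[a₁,…,a₆]` this holds at every finite place iff no prime `q` has `q¹² ∣ Δ` and `q⁴ ∣ c₄`, a
finite check (`q < 512` suffices once `|Δ| < 512¹²`): `Record.minCheck`, decidable, re-run by `decide`.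
* `isGloballyMinimal_of_int_criterion` — the general theorem for an integer Weierstrass model over `ℚ`
  (tree inputs, all PROVED: `isIntegralAt_of_valuation_le_one`, `isMinimalAt_of_lt_valuation_Δ_holds`,
  `isMinimalAt_of_lt_valuation_c₄`, and the valuation of an integer at a place of `𝓞 ℚ`);
* `Record.isGloballyMinimal_of_minCheck`, and the HYPOTHESIS-FREE-IN-INSTANCES forms
  `Record.bsdp_of_claim_of_minCheck` / `bsdp_of_certified_of_claims_of_minCheck`: ten published named
  facts + a passing `check` + a passing `minCheck` + the record's `Claim` ⟹ `BSD(E,p)`;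
* `minCheck_fails_exactly` (by `decide`): among the 85 records exactly six FAIL the sufficient
  criterion — `6240be1@5`, `10080bo1@7`, `10080ca1@5`, `16560cf1@5`, `17360bo1@5` (`ord₂ Δ = 12`,
  `ord₂ c₄ ≥ 4`) and `15390b1@5` (`ord₃ Δ = 12`, `ord₃ c₄ ≥ 4`): minimal by Kraus's conditions at `2`/`3`
  (Cremona), for which the instance hypothesis stays; the other 79 need no instance hypothesis at all.

References: J. H. Silverman, *AEC* VII.1 Remark 1.1, VIII.8 [SilvermanAEC2009]; A. Kraus, Manuscripta
Math. 65 (1989) (the conditions at `2` and `3`, not used) [Kraus1989].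
-/

set_option autoImplicit false

open IsDedekindDomain NumberField Rat.HeightOneSpectrum WeierstrassCurve
  Literature.NumberTheory.EllipticCurves Literature.NumberTheory.EllipticCurves.ModularForms
  Literature.NumberTheory.EllipticCurves.Skinner2016 Literature.NumberTheory.EllipticCurves.Wuthrich2014
  Literature.NumberTheory.EllipticCurves.SteinWuthrich2013
  Literature.NumberTheory.GaloisRepresentations

namespace Literature.NumberTheory.EllipticCurves.Rank1Residual.X11RankOneCertificates

/-! ### The valuation of an integer at a finite place of `ℚ` -/

/-- **`ord_v n < e` when `p_vᵉ ∤ n`**: for an integer `n` and a finite place `v` of `𝓞 ℚ` with prime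
`p_v = natGenerator v`, if `p_vᵉ ∤ n` then `exp (−e) < v(n)` in `ℤᵐ⁰` (else `(n) ⊆ vᵉ = (p_vᵉ)`).
Generalises the tree's `exp_neg_two_lt_valuation_natCast` (squarefree `n`, `e = 2`). [folklore] -/
theorem exp_neg_lt_valuation_intCast_of_not_pow_dvd (v : HeightOneSpectrum (𝓞 ℚ)) {n : ℤ} {e : ℕ}
    (h : ¬ (natGenerator v : ℤ) ^ e ∣ n) :
    WithZero.exp (-(e : ℤ)) < v.valuation ℚ (n : ℚ) := by
  rw [Rat.valuation_intCast, ← not_le]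
  intro hle
  have h₂ : (n : 𝓞 ℚ) ∈ v.asIdeal ^ e := by
    rw [← HeightOneSpectrum.intValuation_le_pow_iff_mem]
    exact_mod_cast hle
  rw [Rat.asIdeal_eq_span_natGenerator, Ideal.span_singleton_pow, Ideal.mem_span_singleton] at h₂
  have h₃ := map_dvd (Rat.IsIntegralClosure.intEquiv (𝓞 ℚ)) h₂
  rw [map_pow, map_natCast, map_intCast] at h₃
  exact h h₃

/-! ### Silverman's sufficient criterion for an integer model -/

/-- **An integer Weierstrass model with no prime `q` such that `q¹² ∣ Δ` and `q⁴ ∣ c₄` is a global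
minimal model over `ℚ`** (Silverman, *AEC* VII.1 Remark 1.1 at every place: integral and
`ord_v Δ < 12` or `ord_v c₄ < 4` ⇒ minimal at `v`; VIII.8: minimal at every `v` ⇒ globally minimal).
`Δ` and `c₄` are the tree-rechecked integers `discOf`/`c4Of` of `Schema.lean`.
[cite: SilvermanAEC2009, VII.1 Remark 1.1] -/
theorem isGloballyMinimal_of_int_criterion (a1 a2 a3 a4 a6 : ℤ)
    (h : ∀ q : ℕ, q.Prime →
      ¬ ((q : ℤ) ^ 12 ∣ discOf [a1, a2, a3, a4, a6] ∧ (q : ℤ) ^ 4 ∣ c4Of [a1, a2, a3, a4, a6])) :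
    (⟨a1, a2, a3, a4, a6⟩ : WeierstrassCurve ℚ).IsGloballyMinimal where
  isIntegral := isIntegral_of_exists_lift (𝓞 ℚ) ⟨(a1 : 𝓞 ℚ), by simp⟩ ⟨(a2 : 𝓞 ℚ), by simp⟩
    ⟨(a3 : 𝓞 ℚ), by simp⟩ ⟨(a4 : 𝓞 ℚ), by simp⟩ ⟨(a6 : 𝓞 ℚ), by simp⟩
  isMinimal v := by
    set W : WeierstrassCurve ℚ := ⟨a1, a2, a3, a4, a6⟩ with hW
    have hle : ∀ m : ℤ, v.valuation ℚ (m : ℚ) ≤ 1 := fun m ↦ by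
      have hm : (m : ℚ) = algebraMap (𝓞 ℚ) ℚ (m : 𝓞 ℚ) := by simp
      rw [hm]
      exact v.valuation_le_one _
    have hint : W.IsIntegralAt v :=
      W.isIntegralAt_of_valuation_le_one v (hle a1) (hle a2) (hle a3) (hle a4) (hle a6)
    have hΔ : W.Δ = ((discOf [a1, a2, a3, a4, a6] : ℤ) : ℚ) := by
      simp only [hW, WeierstrassCurve.Δ, WeierstrassCurve.b₂, WeierstrassCurve.b₄, WeierstrassCurve.b₆,
        WeierstrassCurve.b₈, discOf, invariants]
      push_cast
      ring
    have hc4 : W.c₄ = ((c4Of [a1, a2, a3, a4, a6] : ℤ) : ℚ) := by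
      simp only [hW, WeierstrassCurve.c₄, WeierstrassCurve.b₂, WeierstrassCurve.b₄, c4Of, invariants]
      push_cast
      ring
    rcases not_and_or.mp (h _ (prime_natGenerator v)) with h12 | h4
    · exact isMinimalAt_of_lt_valuation_Δ_holds hint
        (by rw [hΔ]; exact exp_neg_lt_valuation_intCast_of_not_pow_dvd v h12)
    · exact isMinimalAt_of_lt_valuation_c₄ hint
        (by rw [hc4]; exact exp_neg_lt_valuation_intCast_of_not_pow_dvd v h4)

/-! ### The decidable per-record check and its consequences -/

namespace Record

/-- Silverman's sufficient minimality criterion as a decidable check on the record's a-invariants: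
five entries, `Δ ≠ 0`, `|Δ| < 512¹²`, and no `2 ≤ q < 512` with `q¹² ∣ |Δ|` and `q⁴ ∣ |c₄|` (then no prime
at all has both, since `q¹² ∣ Δ ≠ 0` forces `q¹² ≤ |Δ| < 512¹²`). [cite: SilvermanAEC2009, VII.1 Remark 1.1] -/
def minCheck (r : Record) : Bool :=
  (r.ainvs.length == 5) && decide (discOf r.ainvs ≠ 0) && decide ((discOf r.ainvs).natAbs < 512 ^ 12) &&
    (List.range 512).all fun q =>
      decide (q < 2) || !decide (q ^ 12 ∣ (discOf r.ainvs).natAbs) || !decide (q ^ 4 ∣ (c4Of r.ainvs).natAbs)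

/-- From the decidable check to the criterion over ALL primes. [folklore] -/
theorem criterion_of_minCheck {a : List ℤ} (h0 : discOf a ≠ 0) (hlt : (discOf a).natAbs < 512 ^ 12)
    (hall : ∀ q < 512, (q < 2 ∨ ¬ q ^ 12 ∣ (discOf a).natAbs) ∨ ¬ q ^ 4 ∣ (c4Of a).natAbs) :
    ∀ q : ℕ, q.Prime → ¬ ((q : ℤ) ^ 12 ∣ discOf a ∧ (q : ℤ) ^ 4 ∣ c4Of a) := by
  intro q hq ⟨h12, h4⟩
  have h12' : q ^ 12 ∣ (discOf a).natAbs := by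
    rw [← Int.natCast_dvd]; exact_mod_cast h12
  have h4' : q ^ 4 ∣ (c4Of a).natAbs := by
    rw [← Int.natCast_dvd]; exact_mod_cast h4
  by_cases hq512 : q < 512
  · rcases hall q hq512 with (h | h) | h
    · exact absurd hq.two_le (by omega)
    · exact h h12'
    · exact h h4'
  · have hpos : 0 < (discOf a).natAbs := Int.natAbs_pos.mpr h0
    have hle : q ^ 12 ≤ (discOf a).natAbs := Nat.le_of_dvd hpos h12'
    have hge : 512 ^ 12 ≤ q ^ 12 := Nat.pow_le_pow_left (by omega) 12
    omega

/-- **A certified record passing `minCheck` has a globally minimal model** (no hypothesis about the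
curve is assumed). [cite: SilvermanAEC2009, VII.1 Remark 1.1] -/
theorem isGloballyMinimal_of_minCheck (r : Record) (hm : r.minCheck = true) :
    r.curve.IsGloballyMinimal := by
  simp only [minCheck, Bool.and_eq_true, decide_eq_true_eq, beq_iff_eq, List.all_eq_true,
    List.mem_range, Bool.or_eq_true, Bool.not_eq_true', decide_eq_false_iff_not] at hm
  obtain ⟨⟨⟨hlen, h0⟩, hlt⟩, hall⟩ := hm
  rcases hA : r.ainvs with _ | ⟨a1, _ | ⟨a2, _ | ⟨a3, _ | ⟨a4, _ | ⟨a6, _ | ⟨x, t⟩⟩⟩⟩⟩⟩ <;>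
    simp [hA] at hlen
  rw [curve_of_eq hA]
  rw [hA] at h0 hlt hall
  exact isGloballyMinimal_of_int_criterion a1 a2 a3 a4 a6
    (criterion_of_minCheck h0 hlt fun q hq ↦ hall q hq)

/-- **`BSD(E,p)` for a record's curve with NO instance hypothesis**: the published `Inputs`, a passing
recheck `check`, a passing minimality check `minCheck`, and the record's `Claim`. [folklore] -/
theorem bsdp_of_claim_of_minCheck (r : Record) (I : Inputs) (hc : r.check = true)
    (hm : r.minCheck = true) (h : r.Claim) : BSDp r.curve r.p := by
  haveI : r.curve.IsGloballyMinimal := r.isGloballyMinimal_of_minCheck hm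
  exact r.bsdp_of_claim' I hc h

end Record

/-- **List form, instance-free**: for a `Certified` list whose claims hold, `BSD(E,p)` for every listed
record passing `minCheck`, from the TEN published named facts. [folklore] -/
theorem bsdp_of_certified_of_claims_of_minCheck
    (hK : kato_charIdeal_dvd_multiplicative_of_surjective) (hA : thmA_charIdeal_multiplicative)
    (hJs : thm61_splitMultiplicative) (hJn : thm61_nonsplitMultiplicative)
    (hHs : exists_isSplitMultCanonical) (hHn : exists_isMultCanonical)
    (hW : Wuthrich2014.sha_dvd_analyticSha) (hGZK : rank_eq_analyticRank_of_analyticRank_le_one)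
    (hmod : hasEntireLFunction_rat) (hpar : nonempty_modularParametrizationData)
    {rs : List Record} (hC : Certified rs) (hcl : Claims rs) (r : Record) (hr : r ∈ rs)
    (hm : r.minCheck = true) : BSDp r.curve r.p :=
  r.bsdp_of_claim_of_minCheck (inputs_of_published hK hA hJs hJn hHs hHn hW hGZK hmod hpar)
    (hC.check_of_mem hr) hm (hcl r hr)

/-- **Which of the 85 records FAIL the sufficient criterion** (kernel-evaluated): exactly
`6240be1`, `10080bo1`, `10080ca1`, `15390b1`, `16560cf1`, `17360bo1` (`ord₂ Δ = 12` with `ord₂ c₄ ≥ 4`,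
resp. `ord₃ Δ = 12` with `ord₃ c₄ ≥ 4` for `15390b1`; these minimal models are certified outside the kernel
by Kraus's conditions / Tate's algorithm, engines Y and P). The other 79 records satisfy `minCheck`, so
`bsdp_of_certified_of_claims_of_minCheck` applies to them with no instance hypothesis. [folklore] -/
theorem minCheck_fails_exactly :
    ((records1 ++ records2).filter fun r => !r.minCheck).map Record.label =
      ["6240be1", "10080bo1", "10080ca1", "15390b1", "16560cf1", "17360bo1"] := by
  decide +kernel

end Literature.NumberTheory.EllipticCurves.Rank1Residual.X11RankOneCertificates
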